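import Mathlib
import HarnessLib

/-!
# Negative knowledge for the crux `InertialRecession` (item stmt-FinalStateConjecture-10166), VII:
the TAUBERIAN threshold between Cesàro and frozen velocities is the parabolic scale

Refuter file (D-0016 negative lane, `--supports stmt-FinalStateConjecture-10166`); companion of
`CesaroShadow.lean`, `CleanScaleCesaro.lean`, `CleanScaleSharpness.lean`. No Theses decl is asserted.

`tendsto_deriv_of_tendsto_div_of_deriv2_ge` (Landau–Hardy Tauberian theorem for functions; Saari 2005,
*Collisions, Rings, and Other Newtonian N-Body Problems*, Thm. 4.11 with `α = 1`, after Widder): if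
`f(t)/t → A` (a CESÀRO velocity) and the acceleration is bounded below ONE-SIDEDLY by `-B/t`, then
`f' → A` (a FROZEN velocity). Proof: `f' + B log t` is non-decreasing, so `f'` varies by at most
`B log (1 + ε)` on `[t, (1 + ε) t]`, and difference quotients over such windows converge to `A`.

Crux reading (`Disproof.lean` §E): the clean-sphere force available to a hole is `K d_min^{-3/2}`
(`d_min` = distance to the nearest other hole); the Tauberian condition `K d_min^{-3/2} ≤ B/t` holds iff
`d_min ≳ t^{2/3}` — the Newtonian PARABOLIC scale. So once Cesàro velocities are in hand (the typed
conclusion needs no more, card `cesaro-velocities-suffice`), instantaneous velocities converge as well for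
every hole whose partners recede at least parabolically; only sub-parabolic persistent partners (excluded
Newtonianly by Lagrange–Jacobi, not by the typed hypothesis) can keep a velocity wandering — harmlessly.
Consistency with the witnesses: `slowWitness` (`CleanScaleSharpness.lean`) has `|s''| ≤ 3/t` but no
Cesàro limit (the Tauberian theorem needs Cesàro as INPUT); `centre` (`KinematicShadow.lean`) has neither.
-/

set_option linter.dupNamespace false

noncomputable section

namespace Summit.FinalStateConjecture.FinalStateConjecture.Theorems.InertialRecession.Negative

open Filter Set
open scoped Topology

/-- Window inequality: if `f' + B log` is non-decreasing on `[t₀, ∞)` then for `t₀ ≤ t` and `0 < ε`,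
`ε t (f' t - B log (1 + ε)) ≤ f ((1 + ε) t) - f t ≤ ε t (f' ((1 + ε) t) + B log (1 + ε))`. [folklore] -/
lemma window_bounds {f f' : ℝ → ℝ} {t₀ B t ε : ℝ} (ht₀ : 0 < t₀) (hB : 0 ≤ B)
    (hf : ∀ s, t₀ ≤ s → HasDerivAt f (f' s) s)
    (hmono : MonotoneOn (fun s ↦ f' s + B * Real.log s) (Ici t₀)) (ht : t₀ ≤ t) (hε : 0 < ε) :
    ε * t * (f' t - B * Real.log (1 + ε)) ≤ f ((1 + ε) * t) - f t ∧
      f ((1 + ε) * t) - f t ≤ ε * t * (f' ((1 + ε) * t) + B * Real.log (1 + ε)) := by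
  have ht' : 0 < t := lt_of_lt_of_le ht₀ ht
  have hT : t ≤ (1 + ε) * t := by nlinarith
  -- on the window, `f' t - B log(1+ε) ≤ f' s ≤ f' ((1+ε)t) + B log(1+ε)`
  have hlog : ∀ s ∈ Icc t ((1 + ε) * t), Real.log s - Real.log t ≤ Real.log (1 + ε) ∧
      Real.log ((1 + ε) * t) - Real.log s ≤ Real.log (1 + ε) := by
    intro s hs
    have hs0 : 0 < s := lt_of_lt_of_le ht' hs.1
    constructor
    · rw [← Real.log_div hs0.ne' ht'.ne']
      exact Real.log_le_log (by positivity) (by rw [div_le_iff₀ ht']; linarith [hs.2])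
    · rw [← Real.log_div (by positivity) hs0.ne']
      exact Real.log_le_log (by positivity) (by rw [div_le_iff₀ hs0]; nlinarith [hs.1, hs.2])
  have hlow : ∀ s ∈ Icc t ((1 + ε) * t), f' t - B * Real.log (1 + ε) ≤ f' s := by
    intro s hs
    have := hmono (show t ∈ Ici t₀ from ht) (show s ∈ Ici t₀ from ht.trans hs.1) hs.1
    simp only at this
    nlinarith [(hlog s hs).1]
  have hhigh : ∀ s ∈ Icc t ((1 + ε) * t), f' s ≤ f' ((1 + ε) * t) + B * Real.log (1 + ε) := by
    intro s hs
    have := hmono (show s ∈ Ici t₀ from ht.trans hs.1) (show (1 + ε) * t ∈ Ici t₀ from ht.trans hT)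
      hs.2
    simp only at this
    nlinarith [(hlog s hs).2]
  have hcont : ContinuousOn f (Icc t ((1 + ε) * t)) := fun s hs ↦
    (hf s (ht.trans hs.1)).continuousAt.continuousWithinAt
  constructor
  · -- `s ↦ f s - (f' t - B log(1+ε)) s` is monotone on the window
    have hm : MonotoneOn (fun s ↦ f s - (f' t - B * Real.log (1 + ε)) * s) (Icc t ((1 + ε) * t)) := by
      refine monotoneOn_of_hasDerivWithinAt_nonneg (convex_Icc _ _)
        (f' := fun s ↦ f' s - (f' t - B * Real.log (1 + ε)))
        (hcont.sub (continuousOn_const.mul continuousOn_id))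
        (fun s hs ↦ (((hf s (ht.trans (interior_subset hs).1)).sub
          ((hasDerivAt_id s).const_mul _)).congr_deriv (by simp)).hasDerivWithinAt) ?_
      intro s hs
      have := hlow s (interior_subset hs)
      linarith
    have := hm (left_mem_Icc.mpr hT) (right_mem_Icc.mpr hT) hT
    simp only at this
    nlinarith
  · have hm : AntitoneOn (fun s ↦ f s - (f' ((1 + ε) * t) + B * Real.log (1 + ε)) * s)
        (Icc t ((1 + ε) * t)) := by
      refine antitoneOn_of_hasDerivWithinAt_nonpos (convex_Icc _ _)
        (f' := fun s ↦ f' s - (f' ((1 + ε) * t) + B * Real.log (1 + ε)))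
        (hcont.sub (continuousOn_const.mul continuousOn_id))
        (fun s hs ↦ (((hf s (ht.trans (interior_subset hs).1)).sub
          ((hasDerivAt_id s).const_mul _)).congr_deriv (by simp)).hasDerivWithinAt) ?_
      intro s hs
      have := hhigh s (interior_subset hs)
      linarith
    have := hm (left_mem_Icc.mpr hT) (right_mem_Icc.mpr hT) hT
    simp only at this
    nlinarith

/-- **Landau–Hardy Tauberian theorem** (Saari 2005, Thm. 4.11, `α = 1`): a Cesàro velocity plus a
one-sided acceleration bound `f'' ≥ -B/t` is a frozen velocity. [cite: Saari2005, Thm. 4.11] -/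
theorem tendsto_deriv_of_tendsto_div_of_deriv2_ge {f f' f'' : ℝ → ℝ} {t₀ A B : ℝ} (ht₀ : 0 < t₀)
    (hB : 0 ≤ B) (hf : ∀ t, t₀ ≤ t → HasDerivAt f (f' t) t)
    (hf' : ∀ t, t₀ ≤ t → HasDerivAt f' (f'' t) t) (hlow : ∀ t, t₀ ≤ t → -B * t⁻¹ ≤ f'' t)
    (hA : Tendsto (fun t ↦ f t / t) atTop (𝓝 A)) : Tendsto f' atTop (𝓝 A) := by
  -- `f' + B log` is non-decreasing on `[t₀, ∞)`
  have hmono : MonotoneOn (fun s ↦ f' s + B * Real.log s) (Ici t₀) := by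
    refine monotoneOn_of_hasDerivWithinAt_nonneg (convex_Ici t₀)
      (fun s hs ↦ ((hf' s hs).add ((Real.hasDerivAt_log (lt_of_lt_of_le ht₀ hs).ne').const_mul B))
        |>.continuousAt.continuousWithinAt)
      (fun s hs ↦ ((hf' s (interior_subset hs)).add ((Real.hasDerivAt_log
        (lt_of_lt_of_le ht₀ (interior_subset hs)).ne').const_mul B)).hasDerivWithinAt) ?_
    intro s hs
    have hs' : t₀ ≤ s := interior_subset hs
    have := hlow s hs'
    linarith
  -- the two difference quotients and their limits
  have hquot : ∀ ε : ℝ, 0 < ε →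
      Tendsto (fun t ↦ (f ((1 + ε) * t) - f t) / (ε * t)) atTop (𝓝 A) := by
    intro ε hε
    have h1 : Tendsto (fun t ↦ f ((1 + ε) * t) / ((1 + ε) * t)) atTop (𝓝 A) :=
      hA.comp (Tendsto.const_mul_atTop (by linarith) tendsto_id)
    have h2 : Tendsto (fun t ↦ (1 + ε) / ε * (f ((1 + ε) * t) / ((1 + ε) * t)) - ε⁻¹ * (f t / t))
        atTop (𝓝 ((1 + ε) / ε * A - ε⁻¹ * A)) := (h1.const_mul _).sub (hA.const_mul _)
    have hlim : (1 + ε) / ε * A - ε⁻¹ * A = A := by field_simp; ring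
    rw [hlim] at h2
    refine h2.congr' ?_
    filter_upwards [eventually_gt_atTop 0] with t ht
    field_simp
  rw [tendsto_order]
  constructor
  · -- lower bounds: `f' ((1+ε)t) ≥ quotient - B log(1+ε)` eventually
    intro a ha
    obtain ⟨ε, hε, hεlog⟩ : ∃ ε > 0, B * Real.log (1 + ε) < (A - a) / 2 := by
      refine ⟨min 1 ((A - a) / (4 * (B + 1))), by positivity, ?_⟩
      have hle : Real.log (1 + min 1 ((A - a) / (4 * (B + 1)))) ≤ min 1 ((A - a) / (4 * (B + 1))) := by
        have := Real.log_le_sub_one_of_pos (show 0 < 1 + min 1 ((A - a) / (4 * (B + 1))) by positivity)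
        linarith
      have hmin : min 1 ((A - a) / (4 * (B + 1))) ≤ (A - a) / (4 * (B + 1)) := min_le_right _ _
      have hB1 : 0 < B + 1 := by linarith
      calc B * Real.log (1 + min 1 ((A - a) / (4 * (B + 1))))
          ≤ B * ((A - a) / (4 * (B + 1))) := mul_le_mul_of_nonneg_left (hle.trans hmin) hB
        _ ≤ (B + 1) * ((A - a) / (4 * (B + 1))) :=
            mul_le_mul_of_nonneg_right (by linarith) (by positivity)
        _ = (A - a) / 4 := by field_simp
        _ < (A - a) / 2 := by linarith
    have hev : ∀ᶠ t in atTop, t₀ ≤ t ∧ (A - (A - a) / 2) < (f ((1 + ε) * t) - f t) / (ε * t) :=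
      (eventually_ge_atTop t₀).and ((hquot ε hε).eventually (lt_mem_nhds (by linarith)))
    -- transport along `t ↦ (1+ε) t`
    have htrans : Tendsto (fun τ ↦ τ / (1 + ε)) atTop atTop :=
      Tendsto.atTop_div_const (by linarith) tendsto_id
    filter_upwards [htrans.eventually hev] with τ hτ
    obtain ⟨hτ0, hq⟩ := hτ
    have hτeq : (1 + ε) * (τ / (1 + ε)) = τ := by field_simp
    rw [hτeq] at hq
    have hw := (window_bounds ht₀ hB hf hmono hτ0 hε).2
    rw [hτeq] at hw
    have hpos : 0 < ε * (τ / (1 + ε)) := by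
      have : 0 < τ / (1 + ε) := lt_of_lt_of_le ht₀ hτ0
      positivity
    rw [lt_div_iff₀ hpos] at hq
    nlinarith
  · -- upper bounds: `f' t ≤ quotient + B log(1+ε)` eventually
    intro b hb
    obtain ⟨ε, hε, hεlog⟩ : ∃ ε > 0, B * Real.log (1 + ε) < (b - A) / 2 := by
      refine ⟨min 1 ((b - A) / (4 * (B + 1))), by positivity, ?_⟩
      have hle : Real.log (1 + min 1 ((b - A) / (4 * (B + 1)))) ≤ min 1 ((b - A) / (4 * (B + 1))) := by
        have := Real.log_le_sub_one_of_pos (show 0 < 1 + min 1 ((b - A) / (4 * (B + 1))) by positivity)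
        linarith
      have hmin : min 1 ((b - A) / (4 * (B + 1))) ≤ (b - A) / (4 * (B + 1)) := min_le_right _ _
      have hB1 : 0 < B + 1 := by linarith
      calc B * Real.log (1 + min 1 ((b - A) / (4 * (B + 1))))
          ≤ B * ((b - A) / (4 * (B + 1))) := mul_le_mul_of_nonneg_left (hle.trans hmin) hB
        _ ≤ (B + 1) * ((b - A) / (4 * (B + 1))) :=
            mul_le_mul_of_nonneg_right (by linarith) (by positivity)
        _ = (b - A) / 4 := by field_simp
        _ < (b - A) / 2 := by linarith
    have hev : ∀ᶠ t in atTop, t₀ ≤ t ∧ (f ((1 + ε) * t) - f t) / (ε * t) < A + (b - A) / 2 :=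
      (eventually_ge_atTop t₀).and ((hquot ε hε).eventually (gt_mem_nhds (by linarith)))
    filter_upwards [hev] with t ht
    obtain ⟨ht0, hq⟩ := ht
    have hw := (window_bounds ht₀ hB hf hmono ht0 hε).1
    have hpos : 0 < ε * t := by
      have : 0 < t := lt_of_lt_of_le ht₀ ht0
      positivity
    rw [div_lt_iff₀ hpos] at hq
    nlinarith

end Summit.FinalStateConjecture.FinalStateConjecture.Theorems.InertialRecession.Negative

end
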